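import Summits.Ventures.Crystal3D.Theorems.StickyWulffConstantTextureLiminfFluxLines
import HarnessLib

/-!
# Flux count F2c/F2d: the lateral drift of a zigzag line, and the strip-weighted slice volume is at most the number of
# lines with a vertex in a window (lane T, the T-side port of lane G's walker ledger; crux `TextureLiminf`, stmt-Ventures-19483)

HONEST FRAMING. Venture `Summits/Ventures/Crystal3D` (cell `crystal3d-full`), helper `--supports` the crux
`TextureLiminf` (stmt-Ventures-19483) of `route-Ventures-StickyWulffConstant`, registered line `TexShadow` (v6.6; cf-p1
ROUTE.md §86(42) AK: flux count of the per-top walker families, owner wulff-p2).  Rung credit only; F-C1 not moved.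
Model coordinates, ABSTRACT height `⟪·, ν⟫` (`ν` a unit vector: the cell vertical seen from the stacking) and abstract
lateral gauge `lat` (anything with `lat (w + y) ≤ lat w + ‖y‖`: in the cell, the distance of `L w + s` from the axis).

A zigzag polyline `Γ : ℤ → E3` with steps of length `≤ 1` and rises `⟪Γ(k+1) − Γ k, ν⟫ ∈ [r_min, 1]` (`r_min > 0`) drifts
laterally by at most `1/r_min` per unit of height.  Hence if the line through `x ∈ ℝ²` meets the slice
`S ⊆ {z₁ ≤ ⟪w,ν⟫ ≤ z₁+1, lat ≤ R}`, the LATTICE line through `⌊x⌋` (a translate by at most `‖u‖ + ‖v‖ = 2`) has a vertex in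
every lower unit height window `[H, H+1]` (`H + 1 ≤ z₁ − 3`) at lateral gauge `≤ R + 4 + (z₁ + 4 − H)/r_min`:

* `norm_triangularVec₁_one`, `norm_triangularVec₂_one`, `zigChart'_zero_sub` — bookkeeping;
* `height_vertex_sub_le` / `height_vertex_sub_ge` / `lat_vertex_sub_le` — `m` steps down the line lose between `m·r_min`
  and `m` in height and at most `m` in lateral gauge;
* **`exists_vertex_in_window`** — the drift lemma;
* **`lintegral_weightedLength_le_card`** — with `…FluxLines`: for every finite `T ⊆ ℤ²` containing every lattice line with
  such a vertex, `∫⁻_x Σ'_k r_k·|{τ ∈ (0,1) : zigChart' (Γ k) (Γ(k+1) − Γ k) (τ, x) ∈ S}| ≤ #T`.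
With `…FluxChart` the left-hand side is `Σ_k √2·r_k·|S ∩ slab_k|` for a unit slice of the wall cell (next file: the plate).
WHAT THIS IS NOT: not yet the plate statement (sites of a stacking, `plateFlux`); F-C1 not moved.
-/

noncomputable section

namespace Summit.Ventures.Crystal3D.Theorems

open MeasureTheory Set
open scoped ENNReal InnerProductSpace
open Literature.MathematicalPhysics.StatisticalMechanics (triangularVec₁ triangularVec₂)
open Summit.Ventures.Crystal3D.Cruxes.TextureLiminf.TexShadow (E3)

/-! ## Bookkeeping -/

/-- `‖u‖ = 1`. -/
theorem norm_triangularVec₁_one : ‖triangularVec₁ (1 : ℝ)‖ = 1 := by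
  rw [EuclideanSpace.norm_eq, Fin.sum_univ_three]
  simp [triangularVec₁]

/-- `‖v‖ = 1`. -/
theorem norm_triangularVec₂_one : ‖triangularVec₂ (1 : ℝ)‖ = 1 := by
  have h3 : Real.sqrt 3 ^ 2 = 3 := Real.sq_sqrt (by norm_num)
  have habs : |Real.sqrt 3| = Real.sqrt 3 := abs_of_nonneg (Real.sqrt_nonneg 3)
  have hsq : ‖triangularVec₂ (1 : ℝ)‖ ^ 2 = 1 := by
    rw [EuclideanSpace.norm_sq_eq, Fin.sum_univ_three]
    simp [triangularVec₂, habs]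
    nlinarith [h3]
  nlinarith [norm_nonneg (triangularVec₂ (1 : ℝ))]

/-- The vertex of the line through `x`: `zigChart' Γk D (0, x) = x₀ u + x₁ v + Γk` (independent of `D`). -/
theorem zigChart'_zero (Γk D : E3) (x : Fin 2 → ℝ) :
    zigChart' Γk D (0, x) = (x 0) • triangularVec₁ 1 + (x 1) • triangularVec₂ 1 + Γk := by
  simp [zigChart']

/-- A point of the segment is the vertex plus `τ D`. -/
theorem zigChart'_eq_zero_add (Γk D : E3) (τ : ℝ) (x : Fin 2 → ℝ) :
    zigChart' Γk D (τ, x) = zigChart' Γk D (0, x) + τ • D := by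
  simp only [zigChart', zero_smul, add_zero]; abel

/-- Two lines' vertices over the same `Γk` differ by an in-plane vector of norm `≤ |x₀ − x'₀| + |x₁ − x'₁|`. -/
theorem norm_zigChart'_zero_sub_le (Γk D : E3) (x x' : Fin 2 → ℝ) :
    ‖zigChart' Γk D (0, x) - zigChart' Γk D (0, x')‖ ≤ |x 0 - x' 0| + |x 1 - x' 1| := by
  rw [zigChart'_zero, zigChart'_zero]
  have h : (x 0) • triangularVec₁ (1:ℝ) + (x 1) • triangularVec₂ 1 + Γk -
      ((x' 0) • triangularVec₁ 1 + (x' 1) • triangularVec₂ 1 + Γk) =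
      (x 0 - x' 0) • triangularVec₁ 1 + (x 1 - x' 1) • triangularVec₂ 1 := by
    simp only [sub_smul]; abel
  rw [h]
  refine (norm_add_le _ _).trans ?_
  rw [norm_smul, norm_smul, norm_triangularVec₁_one, norm_triangularVec₂_one, mul_one, mul_one,
    Real.norm_eq_abs, Real.norm_eq_abs]

/-- Consecutive vertices of one line differ by the step. -/
theorem zigChart'_zero_succ (Γ : ℤ → E3) (D D' : E3) (x : Fin 2 → ℝ) (k : ℤ) :
    zigChart' (Γ (k + 1)) D' (0, x) = zigChart' (Γ k) D (0, x) + (Γ (k + 1) - Γ k) := by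
  rw [zigChart'_zero, zigChart'_zero]; abel

/-! ## Going down the line: heights and lateral gauge -/

section Descent

variable (ν : E3) (lat : E3 → ℝ) (hlat : ∀ w y : E3, lat (w + y) ≤ lat w + ‖y‖)
  (Γ : ℤ → E3) (r_min : ℝ) (hr : ∀ k : ℤ, r_min ≤ ⟪Γ (k + 1) - Γ k, ν⟫_ℝ)
  (hr1 : ∀ k : ℤ, ⟪Γ (k + 1) - Γ k, ν⟫_ℝ ≤ 1) (hD : ∀ k : ℤ, ‖Γ (k + 1) - Γ k‖ ≤ 1) (x : Fin 2 → ℝ)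

include hr in
/-- `m` steps down lose at least `m·r_min` in height. -/
theorem height_vertex_sub_le (k : ℤ) (m : ℕ) :
    ⟪zigChart' (Γ (k - m)) 0 (0, x), ν⟫_ℝ ≤ ⟪zigChart' (Γ k) 0 (0, x), ν⟫_ℝ - m * r_min := by
  induction m with
  | zero => simp
  | succ m ih =>
    have hstep := zigChart'_zero_succ Γ (0 : E3) 0 x (k - (m + 1 : ℕ))
    have hidx : k - ((m + 1 : ℕ) : ℤ) + 1 = k - (m : ℕ) := by push_cast; ring
    rw [hidx] at hstep
    have hk := hr (k - ((m + 1 : ℕ) : ℤ))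
    rw [hidx] at hk
    rw [hstep, inner_add_left] at ih
    push_cast at ih hk ⊢
    linarith

include hr1 in
/-- `m` steps down lose at most `m` in height. -/
theorem height_vertex_sub_ge (k : ℤ) (m : ℕ) :
    ⟪zigChart' (Γ k) 0 (0, x), ν⟫_ℝ - m ≤ ⟪zigChart' (Γ (k - m)) 0 (0, x), ν⟫_ℝ := by
  induction m with
  | zero => simp
  | succ m ih =>
    have hstep := zigChart'_zero_succ Γ (0 : E3) 0 x (k - (m + 1 : ℕ))
    have hidx : k - ((m + 1 : ℕ) : ℤ) + 1 = k - (m : ℕ) := by push_cast; ring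
    rw [hidx] at hstep
    have hk := hr1 (k - ((m + 1 : ℕ) : ℤ))
    rw [hidx] at hk
    rw [hstep, inner_add_left] at ih
    push_cast at ih hk ⊢
    linarith

include hlat hD in
/-- `m` steps down move the lateral gauge by at most `m`. -/
theorem lat_vertex_sub_le (k : ℤ) (m : ℕ) :
    lat (zigChart' (Γ (k - m)) 0 (0, x)) ≤ lat (zigChart' (Γ k) 0 (0, x)) + m := by
  induction m with
  | zero => simp
  | succ m ih =>
    have hstep := zigChart'_zero_succ Γ (0 : E3) 0 x (k - (m + 1 : ℕ))
    have hidx : k - ((m + 1 : ℕ) : ℤ) + 1 = k - (m : ℕ) := by push_cast; ring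
    rw [hidx] at hstep
    have hk := hD (k - ((m + 1 : ℕ) : ℤ))
    rw [hidx] at hk
    -- `V (k - m - 1) = V (k - m) - D`, so `lat` grows by at most `‖D‖ ≤ 1`
    have heq : zigChart' (Γ (k - (m + 1 : ℕ))) 0 (0, x) =
        zigChart' (Γ (k - (m : ℕ))) 0 (0, x) + -(Γ (k - (m : ℕ)) - Γ (k - (m + 1 : ℕ))) := by
      rw [hstep]; abel
    have h1 := hlat (zigChart' (Γ (k - (m : ℕ))) 0 (0, x)) (-(Γ (k - (m : ℕ)) - Γ (k - (m + 1 : ℕ))))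
    rw [← heq, norm_neg] at h1
    push_cast at ih h1 hk ⊢
    linarith

end Descent

/-! ## The drift lemma -/

/-- **Lateral drift.**  If the line through `x` has a point `zigChart' (Γ k) (Γ(k+1) − Γ k) (τ, x)` (`0 ≤ τ ≤ 1`) in the slice
`{z₁ ≤ ⟪·,ν⟫ ≤ z₁ + 1, lat ≤ R}`, then for every `H` with `H + 1 ≤ z₁ − 3` the LATTICE line through `⌊x⌋` has a vertex of
height in `[H, H + 1]` and lateral gauge `≤ R + 4 + (z₁ + 4 − H)/r_min`. -/
theorem exists_vertex_in_window (ν : E3) (hν : ‖ν‖ = 1) (lat : E3 → ℝ)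
    (hlat : ∀ w y : E3, lat (w + y) ≤ lat w + ‖y‖) (Γ : ℤ → E3) (r_min : ℝ) (hr0 : 0 < r_min)
    (hr : ∀ k : ℤ, r_min ≤ ⟪Γ (k + 1) - Γ k, ν⟫_ℝ) (hr1 : ∀ k : ℤ, ⟪Γ (k + 1) - Γ k, ν⟫_ℝ ≤ 1)
    (hD : ∀ k : ℤ, ‖Γ (k + 1) - Γ k‖ ≤ 1) (x : Fin 2 → ℝ) (k : ℤ) (τ : ℝ) (hτ0 : 0 ≤ τ) (hτ1 : τ ≤ 1)
    (z₁ R H : ℝ) (hH : H + 1 ≤ z₁ - 3)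
    (hQ1 : z₁ ≤ ⟪zigChart' (Γ k) (Γ (k + 1) - Γ k) (τ, x), ν⟫_ℝ)
    (hQ2 : ⟪zigChart' (Γ k) (Γ (k + 1) - Γ k) (τ, x), ν⟫_ℝ ≤ z₁ + 1)
    (hQl : lat (zigChart' (Γ k) (Γ (k + 1) - Γ k) (τ, x)) ≤ R) :
    ∃ k' : ℤ, H ≤ ⟪zigChart' (Γ k') 0 (0, fun i => (⌊x i⌋ : ℝ)), ν⟫_ℝ ∧
      ⟪zigChart' (Γ k') 0 (0, fun i => (⌊x i⌋ : ℝ)), ν⟫_ℝ ≤ H + 1 ∧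
      lat (zigChart' (Γ k') 0 (0, fun i => (⌊x i⌋ : ℝ))) ≤ R + 4 + (z₁ + 4 - H) / r_min := by
  classical
  set t : Fin 2 → ℝ := fun i => (⌊x i⌋ : ℝ) with ht
  set D : E3 := Γ (k + 1) - Γ k with hDdef
  set Q : E3 := zigChart' (Γ k) D (τ, x) with hQ
  set Vx : E3 := zigChart' (Γ k) D (0, x) with hVx
  set V : ℤ → E3 := fun j => zigChart' (Γ j) 0 (0, t) with hV
  -- (1) the vertex of the line through `x`
  have hQV : Q = Vx + τ • D := zigChart'_eq_zero_add (Γ k) D τ x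
  have hτD : ‖τ • D‖ ≤ 1 := by
    rw [norm_smul, Real.norm_eq_abs, abs_of_nonneg hτ0]
    calc τ * ‖D‖ ≤ 1 * 1 := mul_le_mul hτ1 (hD k) (norm_nonneg _) zero_le_one
      _ = 1 := one_mul 1
  have hVxh : ⟪Vx, ν⟫_ℝ = ⟪Q, ν⟫_ℝ - τ * ⟪D, ν⟫_ℝ := by
    rw [hQV, inner_add_left, inner_smul_left, RCLike.conj_to_real]; ring
  have hrk0 : 0 ≤ ⟪D, ν⟫_ℝ := le_trans hr0.le (hr k)
  have hVx1 : z₁ - 1 ≤ ⟪Vx, ν⟫_ℝ := by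
    rw [hVxh]; nlinarith [hr1 k]
  have hVx2 : ⟪Vx, ν⟫_ℝ ≤ z₁ + 1 := by
    rw [hVxh]; nlinarith
  have hVxl : lat Vx ≤ R + 1 := by
    have h1 := hlat Q (-(τ • D))
    rw [show Q + -(τ • D) = Vx by rw [hQV]; abel, norm_neg] at h1
    linarith
  -- (2) the lattice vertex `V k` is within `2` of `Vx`
  have hVk : V k = zigChart' (Γ k) D (0, t) := by simp [hV, zigChart']
  have hdiff : ‖Vx - V k‖ ≤ 2 := by
    rw [hVk, hVx]
    refine (norm_zigChart'_zero_sub_le (Γ k) D x t).trans ?_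
    have h0 : |x 0 - t 0| ≤ 1 := by
      rw [ht]; simp only
      rw [abs_le]; constructor <;> linarith [Int.floor_le (x 0), Int.lt_floor_add_one (x 0)]
    have h1 : |x 1 - t 1| ≤ 1 := by
      rw [ht]; simp only
      rw [abs_le]; constructor <;> linarith [Int.floor_le (x 1), Int.lt_floor_add_one (x 1)]
    linarith
  have hinner_le : ∀ w : E3, |⟪w, ν⟫_ℝ| ≤ ‖w‖ := fun w => by
    have := abs_real_inner_le_norm w ν; rw [hν, mul_one] at this; exact this
  have hVkh1 : z₁ - 3 ≤ ⟪V k, ν⟫_ℝ := by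
    have h := hinner_le (Vx - V k)
    rw [inner_sub_left] at h
    have := (abs_le.1 (h.trans hdiff)).2
    linarith
  have hVkh2 : ⟪V k, ν⟫_ℝ ≤ z₁ + 3 := by
    have h := hinner_le (Vx - V k)
    rw [inner_sub_left] at h
    have := (abs_le.1 (h.trans hdiff)).1
    linarith
  have hVkl : lat (V k) ≤ R + 3 := by
    have h1 := hlat Vx (V k - Vx)
    rw [add_sub_cancel, ← norm_neg, neg_sub] at h1
    linarith
  -- (3) descend: the first vertex below height `H + 1`
  have hV' : ∀ j : ℤ, V j = zigChart' (Γ j) 0 (0, t) := fun j => rfl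
  have hex : ∃ m : ℕ, ⟪V (k - m), ν⟫_ℝ ≤ H + 1 := by
    obtain ⟨m, hm⟩ := exists_nat_gt ((z₁ + 2 - H) / r_min)
    refine ⟨m, ?_⟩
    have h1 := height_vertex_sub_le ν Γ r_min hr t k m
    have h2 : (z₁ + 2 - H) < m * r_min := by rwa [div_lt_iff₀ hr0] at hm
    rw [hV']
    linarith
  let m₀ := Nat.find hex
  have hm₀ : ⟪V (k - m₀), ν⟫_ℝ ≤ H + 1 := Nat.find_spec hex
  have hlow : H ≤ ⟪V (k - m₀), ν⟫_ℝ := by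
    rcases Nat.eq_zero_or_pos m₀ with h0 | hpos
    · have : V (k - m₀) = V k := by rw [h0]; simp
      rw [this]; linarith
    · have hprev : ¬ ⟪V (k - (m₀ - 1 : ℕ)), ν⟫_ℝ ≤ H + 1 := Nat.find_min hex (Nat.sub_lt hpos Nat.one_pos)
      push Not at hprev
      -- one more step down loses at most `1`
      have hstep := zigChart'_zero_succ Γ (0 : E3) 0 t (k - m₀)
      have hidx : k - (m₀ : ℤ) + 1 = k - ((m₀ - 1 : ℕ) : ℤ) := by
        rw [Nat.cast_sub hpos]; push_cast; ring
      rw [hidx] at hstep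
      have hk := hr1 (k - (m₀ : ℤ))
      rw [hidx] at hk
      rw [hV'] at hprev ⊢
      rw [hstep, inner_add_left] at hprev
      linarith
  -- the number of steps
  have hm₀le : (m₀ : ℝ) ≤ (z₁ + 2 - H) / r_min + 1 := by
    by_contra hc
    push Not at hc
    rcases Nat.eq_zero_or_pos m₀ with h0 | hpos
    · rw [h0] at hc; simp at hc
      have : 0 ≤ (z₁ + 2 - H) / r_min := div_nonneg (by linarith) hr0.le
      linarith
    · -- then already `m₀ - 1` steps reach below `H + 1`, contradicting minimality
      have hprev : ¬ ⟪V (k - (m₀ - 1 : ℕ)), ν⟫_ℝ ≤ H + 1 := Nat.find_min hex (Nat.sub_lt hpos Nat.one_pos)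
      have h1 := height_vertex_sub_le ν Γ r_min hr t k (m₀ - 1)
      have hcast : ((m₀ - 1 : ℕ) : ℝ) = (m₀ : ℝ) - 1 := by rw [Nat.cast_sub hpos]; simp
      rw [hcast] at h1
      have h2 : (z₁ + 2 - H) < ((m₀ : ℝ) - 1) * r_min := by
        have := (div_lt_iff₀ hr0).1 (by linarith : (z₁ + 2 - H) / r_min < (m₀ : ℝ) - 1)
        linarith
      rw [hV'] at hprev
      exact hprev (by linarith)
  refine ⟨k - m₀, hlow, hm₀, ?_⟩
  have hl := lat_vertex_sub_le lat hlat Γ hD t k m₀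
  have hnum : (z₁ + 2 - H) / r_min ≤ (z₁ + 4 - H) / r_min := div_le_div_of_nonneg_right (by linarith) hr0.le
  rw [hV'] at hVkl
  linarith

/-! ## The strip-weighted slice volume is at most the number of good lattice lines -/

/-- **Lines versus integral.**  See the module docstring. -/
theorem lintegral_weightedLength_le_card (ν : E3) (hν : ‖ν‖ = 1) (lat : E3 → ℝ)
    (hlat : ∀ w y : E3, lat (w + y) ≤ lat w + ‖y‖) (Γ : ℤ → E3) (r_min : ℝ) (hr0 : 0 < r_min)
    (hr : ∀ k : ℤ, r_min ≤ ⟪Γ (k + 1) - Γ k, ν⟫_ℝ) (hr1 : ∀ k : ℤ, ⟪Γ (k + 1) - Γ k, ν⟫_ℝ ≤ 1)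
    (hD : ∀ k : ℤ, ‖Γ (k + 1) - Γ k‖ ≤ 1) (z₁ R H : ℝ) (hH : H + 1 ≤ z₁ - 3) (S : Set E3)
    (hS : S ⊆ {w : E3 | z₁ ≤ ⟪w, ν⟫_ℝ ∧ ⟪w, ν⟫_ℝ ≤ z₁ + 1 ∧ lat w ≤ R}) (T : Finset (Fin 2 → ℤ))
    (hT : ∀ t : Fin 2 → ℤ, (∃ k' : ℤ, H ≤ ⟪zigChart' (Γ k') 0 (0, fun i => (t i : ℝ)), ν⟫_ℝ ∧
      ⟪zigChart' (Γ k') 0 (0, fun i => (t i : ℝ)), ν⟫_ℝ ≤ H + 1 ∧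
      lat (zigChart' (Γ k') 0 (0, fun i => (t i : ℝ))) ≤ R + 4 + (z₁ + 4 - H) / r_min) → t ∈ T) :
    ∫⁻ x : Fin 2 → ℝ, ∑' k : ℤ, ENNReal.ofReal ⟪Γ (k + 1) - Γ k, ν⟫_ℝ *
        volume {τ : ℝ | zigChart' (Γ k) (Γ (k + 1) - Γ k) (τ, x) ∈ S ∧ 0 < τ ∧ τ < 1} ≤ (T.card : ℝ≥0∞) := by
  refine lintegral_le_card_of_floor_mem _ T (fun x => ?_) (fun x hx => ?_)
  · exact weighted_length_le_one ν Γ z₁ x S (fun w hw => ⟨(hS hw).1, (hS hw).2.1⟩)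
      (fun k => lt_of_lt_of_le hr0 (hr k))
  · -- some step of the line through `x` meets `S`
    obtain ⟨k, hk⟩ : ∃ k : ℤ, ENNReal.ofReal ⟪Γ (k + 1) - Γ k, ν⟫_ℝ *
        volume {τ : ℝ | zigChart' (Γ k) (Γ (k + 1) - Γ k) (τ, x) ∈ S ∧ 0 < τ ∧ τ < 1} ≠ 0 := by
      by_contra h
      push Not at h
      exact hx (ENNReal.tsum_eq_zero.2 h)
    have hvol : volume {τ : ℝ | zigChart' (Γ k) (Γ (k + 1) - Γ k) (τ, x) ∈ S ∧ 0 < τ ∧ τ < 1} ≠ 0 :=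
      fun h0 => hk (by rw [h0, mul_zero])
    obtain ⟨τ, hτS, hτ0, hτ1⟩ := nonempty_of_measure_ne_zero hvol
    obtain ⟨h1, h2, h3⟩ := hS hτS
    obtain ⟨k', hk'⟩ := exists_vertex_in_window ν hν lat hlat Γ r_min hr0 hr hr1 hD x k τ hτ0.le hτ1.le z₁ R H hH
      h1 h2 h3
    exact hT _ ⟨k', hk'⟩

end Summit.Ventures.Crystal3D.Theorems

end
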